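import Mathlib
import Summits.AtomisticToContinuum.HydrodynamicLimit.Theorems.JaynesSqueezeEntropicWeakStrongHSShellA
import Literature.MathematicalPhysics.KineticTheory.HardSphereEuler
import HarnessLib

/-!
# `EntropicWeakStrongHS` (stmt-AtomisticToContinuum-13461), part B: the abstract Dafermos
# relative-entropy stability shell

`shell_core`: the measure-theoretic half of Dafermos' relative-entropy stability argument in
a-priori form (Dafermos 1979; DiPerna 1979), with every piece of PDE information abstracted into
pointwise hypotheses. Data: a "classical state" `U(τ, x)`, its entropy variables `lam(τ, x)` and
their derivatives `Dτ`, `D i` (all jointly continuous on `ℝ × 𝕋³`), an entropy `h` and fluxes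
`flux i` continuous on a compact set `K` of states, the exact bookkeeping identity `Γ ≡ 0` of the
classical state (entropy conservation + weak form against its own entropy variables), the
pointwise quadratic bound of the relative flux by the relative entropy density (constant `C₁`) and
the coercivity of the relative entropy density (constant `C₂`). Conclusion: for every `ε > 0` there
is `δ > 0` such that every measurable `K`-valued field `V` with global entropy at most
`∫ h(U(0)) + δ`, initial `L²`-distance at most `δ` and weak-form residual at most `δ` stays within
`L²`-distance `ε` of `U` on `[0, t]` (relative entropy `ℰ(s) ≤ 2δ + 3M√δ + C₁ ∫₀ˢ ℰ`, Grönwall).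
-/

noncomputable section

open MeasureTheory Set Filter Function
open scoped BigOperators Topology

namespace Summit.AtomisticToContinuum.HydrodynamicLimit.Theorems.EntropicWeakStrong

open Literature.MathematicalPhysics.KineticTheory (T3 V3)

/-- **Abstract Dafermos stability shell** (globally continuous classical data). See the module
docstring. -/
theorem shell_core {t : ℝ} (ht : 0 ≤ t) {K : Set (ℝ × V3 × ℝ)} (hK : IsCompact K)
    (pair : (ℝ × V3 × ℝ) → (ℝ × V3 × ℝ) → ℝ)
    (hpair : pair = fun L U => L.1 * U.1 + (∑ j, L.2.1 j * U.2.1 j) + L.2.2 * U.2.2)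
    {U lam Dτ : ℝ → T3 → (ℝ × V3 × ℝ)} {D : Fin 3 → ℝ → T3 → (ℝ × V3 × ℝ)} {h : (ℝ × V3 × ℝ) → ℝ} {flux : Fin 3 → (ℝ × V3 × ℝ) → (ℝ × V3 × ℝ)}
    (hU : Continuous (uncurry U)) (hlam : Continuous (uncurry lam))
    (hDτ : Continuous (uncurry Dτ)) (hD : ∀ i, Continuous (uncurry (D i)))
    (hhU : Continuous (fun p : ℝ × T3 => h (U p.1 p.2)))
    (hfU : ∀ i, Continuous (fun p : ℝ × T3 => flux i (U p.1 p.2)))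
    (hhK : ContinuousOn h K) (hfK : ∀ i, ContinuousOn (flux i) K)
    (hΓ : ∀ s ∈ Icc 0 t, (∫ x, h (U s x)) - (∫ x, h (U 0 x)) =
      (∫ x, pair (lam s x) (U s x)) - (∫ x, pair (lam 0 x) (U 0 x)) -
        ∫ τ in (0:ℝ)..s, ∫ x, (pair (Dτ τ x) (U τ x) + ∑ i, pair (D i τ x) (flux i (U τ x))))
    {C₁ C₂ : ℝ} (hC₁ : 0 ≤ C₁) (hC₂ : 0 ≤ C₂)
    (hnonneg : ∀ τ ∈ Icc 0 t, ∀ x, ∀ V ∈ K, 0 ≤ h V - h (U τ x) - pair (lam τ x) (V - U τ x))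
    (hquad : ∀ τ ∈ Icc 0 t, ∀ x, ∀ V ∈ K,
      |pair (Dτ τ x) (V - U τ x) + ∑ i, pair (D i τ x) (flux i V - flux i (U τ x))| ≤
        C₁ * (h V - h (U τ x) - pair (lam τ x) (V - U τ x)))
    (hcoer : ∀ τ ∈ Icc 0 t, ∀ x, ∀ V ∈ K,
      (V.1 - (U τ x).1) ^ 2 + ‖V.2.1 - (U τ x).2.1‖ ^ 2 + (V.2.2 - (U τ x).2.2) ^ 2 ≤
        C₂ * (h V - h (U τ x) - pair (lam τ x) (V - U τ x))) :
    ∀ ε : ℝ, 0 < ε → ∃ δ : ℝ, 0 < δ ∧ ∀ V : ℝ → T3 → (ℝ × V3 × ℝ), Measurable (uncurry V) →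
      (∀ s x, V s x ∈ K) →
      (∀ s ∈ Icc 0 t, ∫ x, h (V s x) ≤ (∫ x, h (U 0 x)) + δ) →
      (∫ x, ((V 0 x).1 - (U 0 x).1) ^ 2 + ‖(V 0 x).2.1 - (U 0 x).2.1‖ ^ 2 +
          ((V 0 x).2.2 - (U 0 x).2.2) ^ 2) ≤ δ →
      (∀ s ∈ Icc 0 t, |(∫ x, pair (lam s x) (V s x)) - (∫ x, pair (lam 0 x) (V 0 x)) -
        ∫ τ in (0:ℝ)..s, ∫ x, (pair (Dτ τ x) (V τ x) +
          ∑ i, pair (D i τ x) (flux i (V τ x)))| ≤ δ) →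
      ∀ s ∈ Icc 0 t, (∫ x, ((V s x).1 - (U s x).1) ^ 2 + ‖(V s x).2.1 - (U s x).2.1‖ ^ 2 +
          ((V s x).2.2 - (U s x).2.2) ^ 2) ≤ ε := by
  intro ε hε
  have hpc := continuous_pair pair hpair
  -- (1) bound on the entropy variables at time `0`
  have hlam0 : Continuous fun x : T3 => lam 0 x :=
    hlam.comp (continuous_const.prodMk continuous_id)
  obtain ⟨M₀, hM₀⟩ := isCompact_univ.exists_bound_of_continuousOn hlam0.continuousOn
  set M : ℝ := max M₀ 0 with hMdef
  have hM0 : 0 ≤ M := le_max_right _ _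
  have hMc : ∀ x, |(lam 0 x).1| ≤ M ∧ (∀ j, |(lam 0 x).2.1 j| ≤ M) ∧ |(lam 0 x).2.2| ≤ M := by
    intro x
    have hn : ‖lam 0 x‖ ≤ M := (hM₀ x (mem_univ _)).trans (le_max_left _ _)
    obtain ⟨a, b, c⟩ := abs_components_le_norm (lam 0 x)
    exact ⟨a.trans hn, fun j => (b j).trans hn, c.trans hn⟩
  -- (2) uniform bounds by compactness
  obtain ⟨BH, hBH0, hBH⟩ := exists_bound_of_continuousOn_slab hK (t := t)
    (G := fun q => h q.2 - h (U q.1.1 q.1.2) - pair (lam q.1.1 q.1.2) (q.2 - U q.1.1 q.1.2)) (by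
      refine ContinuousOn.sub (ContinuousOn.sub (hhK.comp continuousOn_snd fun q hq => hq.2)
        ((hhU.comp continuous_fst).continuousOn)) ?_
      exact (hpc.comp ((hlam.comp continuous_fst).prodMk
        (continuous_snd.sub (hU.comp continuous_fst)))).continuousOn)
  obtain ⟨BF, hBF0, hBF⟩ := exists_bound_of_continuousOn_slab hK (t := t)
    (G := fun q => pair (Dτ q.1.1 q.1.2) q.2 + ∑ i, pair (D i q.1.1 q.1.2) (flux i q.2)) (by
      refine ContinuousOn.add (hpc.comp ((hDτ.comp continuous_fst).prodMk
        continuous_snd)).continuousOn (continuousOn_finsetSum _ fun i _ => ?_)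
      exact hpc.comp_continuousOn (((hD i).comp continuous_fst).continuousOn.prodMk
        ((hfK i).comp continuousOn_snd fun q hq => hq.2)))
  obtain ⟨BU, hBU0, hBU⟩ := exists_bound_of_continuousOn_slab' (t := t)
    (G := fun p => pair (Dτ p.1 p.2) (U p.1 p.2) + ∑ i, pair (D i p.1 p.2) (flux i (U p.1 p.2)))
    ((hpc.comp (hDτ.prodMk hU)).add
      (continuous_finsetSum _ fun i _ => hpc.comp ((hD i).prodMk (hfU i)))).continuousOn
  obtain ⟨BP, hBP0, hBP⟩ := exists_bound_of_continuousOn_slab hK (t := t)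
    (G := fun q => pair (lam q.1.1 q.1.2) q.2)
    (hpc.comp ((hlam.comp continuous_fst).prodMk continuous_snd)).continuousOn
  obtain ⟨Bh, hBh⟩ := hK.exists_bound_of_continuousOn hhK
  -- (3) choice of `δ`
  set G : ℝ := Real.exp (C₁ * t) with hGdef
  have hG0 : 0 < G := Real.exp_pos _
  set Λ : ℝ := C₂ * G * (2 + 3 * M) + 1 with hΛdef
  have hΛ1 : 1 ≤ Λ := by
    have : 0 ≤ C₂ * G * (2 + 3 * M) := by positivity
    linarith
  have hΛ0 : 0 < Λ := by linarith
  set δ : ℝ := min 1 ((ε / Λ) ^ 2) with hδdef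
  have hεΛ : 0 < ε / Λ := div_pos hε hΛ0
  have hδ0 : 0 < δ := lt_min one_pos (pow_pos hεΛ 2)
  have hδ1 : δ ≤ 1 := min_le_left _ _
  set κ : ℝ := Real.sqrt δ with hκdef
  have hκ0 : 0 < κ := Real.sqrt_pos.2 hδ0
  have hκle : κ ≤ ε / Λ := by
    rw [hκdef, ← Real.sqrt_sq hεΛ.le]
    exact Real.sqrt_le_sqrt (min_le_right _ _)
  have hδκ : δ ≤ κ := by
    rw [hκdef, Real.le_sqrt hδ0.le hδ0.le]
    nlinarith
  have hδκ' : δ / κ = κ := by rw [hκdef]; exact Real.div_sqrt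
  set A : ℝ := 2 * δ + 3 * M * κ with hAdef
  have hA0 : 0 ≤ A := by positivity
  have hfinal : C₂ * (A * G) ≤ ε := by
    have h1 : A ≤ (2 + 3 * M) * κ := by rw [hAdef]; nlinarith
    have h2 : C₂ * (A * G) ≤ C₂ * G * (2 + 3 * M) * κ := by
      have := mul_le_mul_of_nonneg_left h1 (mul_nonneg hC₂ hG0.le)
      calc C₂ * (A * G) = C₂ * G * A := by ring
        _ ≤ C₂ * G * ((2 + 3 * M) * κ) := this
        _ = C₂ * G * (2 + 3 * M) * κ := by ring
    have h3 : C₂ * G * (2 + 3 * M) * κ ≤ (Λ - 1) * (ε / Λ) := by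
      have : C₂ * G * (2 + 3 * M) = Λ - 1 := by rw [hΛdef]; ring
      rw [this]
      exact mul_le_mul_of_nonneg_left hκle (by linarith)
    have h4 : (Λ - 1) * (ε / Λ) ≤ ε := by
      rw [mul_div_assoc']
      rw [div_le_iff₀ hΛ0]
      nlinarith
    linarith
  refine ⟨δ, hδ0, ?_⟩
  intro V hVm hVK hent hd0 hW
  -- (4) measurability
  have hVτ : ∀ τ, Measurable (V τ) := fun τ => hVm.comp (measurable_const.prodMk measurable_id)
  have mflux : ∀ i, Measurable (fun p : ℝ × T3 => flux i (V p.1 p.2)) := fun i =>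
    measurable_comp_of_continuousOn' (hfK i) hVm fun p => hVK p.1 p.2
  have mhV : Measurable (fun p : ℝ × T3 => h (V p.1 p.2)) :=
    measurable_comp_of_continuousOn hhK hVm fun p => hVK p.1 p.2
  have mF : Measurable (fun p : ℝ × T3 =>
      pair (Dτ p.1 p.2) (V p.1 p.2) + ∑ i, pair (D i p.1 p.2) (flux i (V p.1 p.2))) := by
    refine Measurable.add (hpc.measurable.comp (hDτ.measurable.prodMk hVm)) ?_
    refine Finset.measurable_sum _ fun i _ => ?_
    exact hpc.measurable.comp ((hD i).measurable.prodMk (mflux i))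
  have mFU : Measurable (fun p : ℝ × T3 =>
      pair (Dτ p.1 p.2) (U p.1 p.2) + ∑ i, pair (D i p.1 p.2) (flux i (U p.1 p.2))) :=
    ((hpc.comp (hDτ.prodMk hU)).add
      (continuous_finsetSum _ fun i _ => hpc.comp ((hD i).prodMk (hfU i)))).measurable
  have mH : Measurable (fun p : ℝ × T3 =>
      h (V p.1 p.2) - h (U p.1 p.2) - pair (lam p.1 p.2) (V p.1 p.2 - U p.1 p.2)) :=
    (mhV.sub hhU.measurable).sub (hpc.measurable.comp (hlam.measurable.prodMk (hVm.sub hU.measurable)))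
  have mP : Measurable (fun p : ℝ × T3 => pair (lam p.1 p.2) (V p.1 p.2)) :=
    hpc.measurable.comp (hlam.measurable.prodMk hVm)
  have mdist : Measurable (fun p : ℝ × T3 => ((V p.1 p.2).1 - (U p.1 p.2).1) ^ 2 +
      ‖(V p.1 p.2).2.1 - (U p.1 p.2).2.1‖ ^ 2 + ((V p.1 p.2).2.2 - (U p.1 p.2).2.2) ^ 2) := by
    have hc : Continuous (fun q : (ℝ × V3 × ℝ) × (ℝ × V3 × ℝ) => (q.1.1 - q.2.1) ^ 2 + ‖q.1.2.1 - q.2.2.1‖ ^ 2 +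
        (q.1.2.2 - q.2.2.2) ^ 2) := by fun_prop
    exact hc.measurable.comp (hVm.prodMk hU.measurable)
  -- sections at fixed time are measurable
  have sec : ∀ {F : ℝ × T3 → ℝ}, Measurable F → ∀ τ, Measurable fun x => F (τ, x) :=
    fun hF τ => hF.comp (measurable_const.prodMk measurable_id)
  -- (5) the relative entropy, the flux pairings, integrability
  set ℰ : ℝ → ℝ := fun τ => ∫ x, (h (V τ x) - h (U τ x) - pair (lam τ x) (V τ x - U τ x))
    with hℰdef
  set XV : ℝ → ℝ := fun τ => ∫ x, (pair (Dτ τ x) (V τ x) + ∑ i, pair (D i τ x) (flux i (V τ x)))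
    with hXVdef
  set XU : ℝ → ℝ := fun τ => ∫ x, (pair (Dτ τ x) (U τ x) + ∑ i, pair (D i τ x) (flux i (U τ x)))
    with hXUdef
  have hℰm : Measurable ℰ := measurable_integral_of_measurable mH
  have hXVm : Measurable XV := measurable_integral_of_measurable mF
  have hXUm : Measurable XU := measurable_integral_of_measurable mFU
  have hℰB : ∀ τ ∈ Icc 0 t, |ℰ τ| ≤ BH := fun τ hτ =>
    abs_integral_le_of_abs_le fun x => hBH τ hτ x (V τ x) (hVK τ x)
  have hℰ0 : ∀ τ ∈ Icc 0 t, 0 ≤ ℰ τ := fun τ hτ =>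
    integral_nonneg fun x => hnonneg τ hτ x (V τ x) (hVK τ x)
  have hXVB : ∀ τ ∈ Icc 0 t, |XV τ| ≤ BF := fun τ hτ =>
    abs_integral_le_of_abs_le fun x => hBF τ hτ x (V τ x) (hVK τ x)
  have hXUB : ∀ τ ∈ Icc 0 t, |XU τ| ≤ BU := fun τ hτ =>
    abs_integral_le_of_abs_le fun x => hBU τ hτ x
  have iH : ∀ τ ∈ Icc 0 t, Integrable (fun x => h (V τ x) - h (U τ x) -
      pair (lam τ x) (V τ x - U τ x)) volume := fun τ hτ =>
    integrable_of_abs_le (sec mH τ) fun x => hBH τ hτ x (V τ x) (hVK τ x)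
  have iF : ∀ τ ∈ Icc 0 t, Integrable (fun x => pair (Dτ τ x) (V τ x) +
      ∑ i, pair (D i τ x) (flux i (V τ x))) volume := fun τ hτ =>
    integrable_of_abs_le (sec mF τ) fun x => hBF τ hτ x (V τ x) (hVK τ x)
  have iFU : ∀ τ ∈ Icc 0 t, Integrable (fun x => pair (Dτ τ x) (U τ x) +
      ∑ i, pair (D i τ x) (flux i (U τ x))) volume := fun τ hτ =>
    integrable_of_abs_le (sec mFU τ) fun x => hBU τ hτ x
  have ihV : ∀ τ, Integrable (fun x => h (V τ x)) volume := fun τ =>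
    integrable_of_abs_le (sec mhV τ) fun x => by
      have := hBh (V τ x) (hVK τ x); rwa [Real.norm_eq_abs] at this
  have ihU : ∀ τ, Integrable (fun x => h (U τ x)) volume := fun τ =>
    (hhU.comp (continuous_const.prodMk continuous_id)).integrable_unitAddTorus
  have iPV : ∀ τ ∈ Icc 0 t, Integrable (fun x => pair (lam τ x) (V τ x)) volume := fun τ hτ =>
    integrable_of_abs_le (sec mP τ) fun x => hBP τ hτ x (V τ x) (hVK τ x)
  have iPU : ∀ τ, Integrable (fun x => pair (lam τ x) (U τ x)) volume := fun τ =>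
    ((hpc.comp (hlam.prodMk hU)).comp (continuous_const.prodMk continuous_id)).integrable_unitAddTorus
  -- (6) the main inequality `ℰ(s) ≤ A + C₁ ∫₀ˢ ℰ`
  have hmain : ∀ s ∈ Icc 0 t, ℰ s ≤ A + C₁ * ∫ τ in (0:ℝ)..s, ℰ τ := by
    intro s hs
    have h0t : (0:ℝ) ∈ Icc 0 t := ⟨le_rfl, ht⟩
    -- (a) split the relative entropy
    have hEs : ℰ s = (∫ x, h (V s x)) - (∫ x, h (U s x)) -
        ((∫ x, pair (lam s x) (V s x)) - ∫ x, pair (lam s x) (U s x)) := by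
      simp only [hℰdef]
      simp_rw [pair_sub pair hpair]
      have hA : Integrable (fun x => h (V s x) - h (U s x)) volume := (ihV s).sub (ihU s)
      have hB : Integrable (fun x => pair (lam s x) (V s x) - pair (lam s x) (U s x)) volume :=
        (iPV s hs).sub (iPU s)
      rw [integral_sub hA hB, integral_sub (ihV s) (ihU s), integral_sub (iPV s hs) (iPU s)]
    -- (b) the residual hypothesis
    have hWs := hW s hs
    rw [abs_le] at hWs
    -- (c) the initial pairing
    have hinit : |(∫ x, pair (lam 0 x) (V 0 x)) - ∫ x, pair (lam 0 x) (U 0 x)| ≤ 3 * M * κ := by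
      rw [← integral_sub (iPV 0 h0t) (iPU 0)]
      simp_rw [← pair_sub pair hpair]
      have hpt : ∀ x, |pair (lam 0 x) (V 0 x - U 0 x)| ≤ M / 2 * (5 * κ +
          (((V 0 x).1 - (U 0 x).1) ^ 2 + ‖(V 0 x).2.1 - (U 0 x).2.1‖ ^ 2 +
            ((V 0 x).2.2 - (U 0 x).2.2) ^ 2) / κ) := fun x =>
        abs_pair_le_sqrt_absorb pair hpair (hMc x).1 (hMc x).2.1 (hMc x).2.2 hκ0 (V 0 x - U 0 x)
      have idist : Integrable (fun x => ((V 0 x).1 - (U 0 x).1) ^ 2 +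
          ‖(V 0 x).2.1 - (U 0 x).2.1‖ ^ 2 + ((V 0 x).2.2 - (U 0 x).2.2) ^ 2) volume := by
        refine integrable_of_abs_le (sec mdist 0) (B := C₂ * BH) fun x => ?_
        rw [abs_of_nonneg (by positivity)]
        refine (hcoer 0 h0t x (V 0 x) (hVK 0 x)).trans ?_
        exact mul_le_mul_of_nonneg_left ((le_abs_self _).trans (hBH 0 h0t x (V 0 x) (hVK 0 x))) hC₂
      have ig : Integrable (fun x => M / 2 * (5 * κ +
          (((V 0 x).1 - (U 0 x).1) ^ 2 + ‖(V 0 x).2.1 - (U 0 x).2.1‖ ^ 2 +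
            ((V 0 x).2.2 - (U 0 x).2.2) ^ 2) / κ)) volume :=
        ((integrable_const _).add (idist.div_const κ)).const_mul _
      have h1 := norm_integral_le_of_norm_le ig (Eventually.of_forall fun x => by
        rw [Real.norm_eq_abs]; exact hpt x)
      rw [Real.norm_eq_abs] at h1
      refine h1.trans ?_
      rw [integral_const_mul, integral_add (integrable_const _) (idist.div_const κ),
        integral_const, probReal_univ, one_smul, integral_div]
      have h2 : (∫ x, ((V 0 x).1 - (U 0 x).1) ^ 2 + ‖(V 0 x).2.1 - (U 0 x).2.1‖ ^ 2 +
          ((V 0 x).2.2 - (U 0 x).2.2) ^ 2) / κ ≤ κ := by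
        rw [div_le_iff₀ hκ0]
        refine hd0.trans (le_of_eq ?_)
        rw [hκdef]; exact (Real.mul_self_sqrt hδ0.le).symm
      nlinarith
    -- (d) the time-integrated relative flux
    have hsub' : ∀ τ ∈ Icc 0 s, τ ∈ Icc 0 t := fun τ hτ => ⟨hτ.1, hτ.2.trans hs.2⟩
    have hflux : |(∫ τ in (0:ℝ)..s, XV τ) - ∫ τ in (0:ℝ)..s, XU τ| ≤ C₁ * ∫ τ in (0:ℝ)..s, ℰ τ := by
      have iXV : IntervalIntegrable XV volume 0 s := intervalIntegrable_of_bound_on hXVm hXVB hs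
      have iXU : IntervalIntegrable XU volume 0 s := intervalIntegrable_of_bound_on hXUm hXUB hs
      have iℰ : IntervalIntegrable ℰ volume 0 s := intervalIntegrable_of_bound_on hℰm hℰB hs
      rw [← intervalIntegral.integral_sub iXV iXU, ← intervalIntegral.integral_const_mul]
      refine (intervalIntegral.abs_integral_le_integral_abs hs.1).trans ?_
      refine intervalIntegral.integral_mono_on hs.1 (iXV.sub iXU).abs (iℰ.const_mul C₁) ?_
      intro τ hτ
      have hτt := hsub' τ hτ
      -- pointwise: `XV τ - XU τ = ∫ Ψ` and `|Ψ| ≤ C₁ Hrel`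
      have hdiff : XV τ - XU τ = ∫ x, (pair (Dτ τ x) (V τ x - U τ x) +
          ∑ i, pair (D i τ x) (flux i (V τ x) - flux i (U τ x))) := by
        simp only [hXVdef, hXUdef]
        rw [← integral_sub (iF τ hτt) (iFU τ hτt)]
        refine integral_congr_ae (Eventually.of_forall fun x => ?_)
        simp only [pair_sub pair hpair, Finset.sum_sub_distrib]
        ring
      rw [hdiff]
      have ig : Integrable (fun x => C₁ * (h (V τ x) - h (U τ x) -
          pair (lam τ x) (V τ x - U τ x))) volume := (iH τ hτt).const_mul C₁
      have h1 := norm_integral_le_of_norm_le ig (Eventually.of_forall fun x => by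
        rw [Real.norm_eq_abs]; exact hquad τ hτt x (V τ x) (hVK τ x))
      rw [Real.norm_eq_abs] at h1
      refine h1.trans ?_
      rw [integral_const_mul]
    -- (e) combine
    have hΓs := hΓ s hs
    have hents := hent s hs
    rw [abs_le] at hinit hflux
    rw [hEs]
    linarith [hinit.1, hinit.2, hflux.1, hflux.2, hWs.1, hWs.2]
  -- (7) Grönwall and coercivity
  have hgr := gronwall_measurable_bounded hℰm ht hA0 hC₁ hℰB hmain
  intro s hs
  have hEs := hgr s hs
  have idist : Integrable (fun x => ((V s x).1 - (U s x).1) ^ 2 +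
      ‖(V s x).2.1 - (U s x).2.1‖ ^ 2 + ((V s x).2.2 - (U s x).2.2) ^ 2) volume := by
    refine integrable_of_abs_le (sec mdist s) (B := C₂ * BH) fun x => ?_
    rw [abs_of_nonneg (by positivity)]
    refine (hcoer s hs x (V s x) (hVK s x)).trans ?_
    exact mul_le_mul_of_nonneg_left ((le_abs_self _).trans (hBH s hs x (V s x) (hVK s x))) hC₂
  calc (∫ x, ((V s x).1 - (U s x).1) ^ 2 + ‖(V s x).2.1 - (U s x).2.1‖ ^ 2 +
        ((V s x).2.2 - (U s x).2.2) ^ 2)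
      ≤ ∫ x, C₂ * (h (V s x) - h (U s x) - pair (lam s x) (V s x - U s x)) :=
        integral_mono idist ((iH s hs).const_mul C₂) fun x => hcoer s hs x (V s x) (hVK s x)
    _ = C₂ * ℰ s := integral_const_mul _ _
    _ ≤ C₂ * (A * G) := mul_le_mul_of_nonneg_left hEs hC₂
    _ ≤ ε := hfinal

end Summit.AtomisticToContinuum.HydrodynamicLimit.Theorems.EntropicWeakStrong

end
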